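import Mathlib
import HarnessLib
import Summits.ValiantsHypothesis.ValiantsHypothesis.Theorems.LacunarySymmetroidMatrixDescartesProductPlusOneFarKneesMerge
import Summits.ValiantsHypothesis.ValiantsHypothesis.Theorems.LacunarySymmetroidMatrixDescartesProductPlusOneOneBump

/-!
# LINE (A) `product_plus_one` (crux `MatrixDescartes`, stmt-ValiantsHypothesis-18050, V1) — W-CB accounting cell:
# a FAR CLUSTER of same-rate top knees against a background cloud carries at most TWO zeros of `W(∏f)` per window

Owner memo `pub/ideators/val-idea-25/NOTE-idea25g3-18050-LINEA-AB-reduction.md` §26.5 (merging lemma (M)) and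
`pub/val-lit/lmr/NOTE-p8g17-18050-pure-2N-law.md` §9 (val-lit-p8 g17).  In the tower currency of ✓ `…CloudDefs` (`ψ₁ = rowPsi1`, window
`(u,v) ⊂ (0,∞)`) the company's `W(∏f_j)/∏f_j² = −Σ_j ψ₁^{(j)}` (✓ `logWronskian_prod_eq_rowPsi1_sum`); a TOP knee row (letters `(a, 0, c)`,
`a·c < 0`) has `ψ₁ = −q²·λx^q/(1+λx^q)²`, `q = e₁+e₂+2`, `λ = −c/a > 0`.  If every knee of the cluster is FAR LEFT of the window
(`λ_j u^q ≥ 2`, i.e. centre at distance `≥ ln 2/q` left of `u` in `log x`), the weighted cluster aggregate is strictly log-concave on the window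
(✓ `kneeAggregate_logConcave_of_far`), the background cloud is positive and log-convex (✓ `backgroundCloud_lcP1`), and the engine
✓ `no_three_zeros_of_logConcave_sub_logConvex` gives:

* ★ `farKneeCluster_backgroundCloud_no_three_zeros` (all knees far LEFT) and `…_right` (all far RIGHT) — `Σ_{j∈J} w_j ψ₁^{(j)} + cloudP1` does not
  vanish at three points of the window: the
  cluster counts as ONE knee (the (M) input of the floor's summable accounting, margin `ln 2/q`, sharp).  Background menu = the `hrow` of
  ✓ `hump_backgroundCloud_no_three_zeros` (one-change binomials on any pair with root outside, unswitched incoherent, switched coherent rows).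

Honest framing: one W-cell (helper); nothing here proves `WronskianBudgetK3` / `OneChangeFloorK3` / the stubs / 18050 / `MatrixDescartes`;
`VP ≠ VNP` is NOT proved.  No definitions, no named facts.
-/

set_option linter.dupNamespace false

namespace Summit.ValiantsHypothesis.ValiantsHypothesis.Theorems.LacunarySymmetroidMatrixDescartes

namespace ProductPlusOne

open Set Finset
open scoped BigOperators Topology

/-- The top knee's `ψ₁` in aggregate form: for letters `(a, 0, c)` with `a·c < 0` and `λ := −c/a`,
`rowPsi1 e₁ e₂ a 0 c x = −q²·(λx^q/(1+λx^q)²)`, `q = e₁+e₂+2`. [this file's lemma] -/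
theorem topKnee_rowPsi1_eq_aggregate (e₁ e₂ : ℕ) {a c x : ℝ} (hac : a * c < 0) (hx : 0 < x) :
    rowPsi1 e₁ e₂ a 0 c x = -(((e₁ : ℝ) + e₂ + 2) ^ 2) *
      ((-c / a) * x ^ (e₁ + e₂ + 2) / (1 + (-c / a) * x ^ (e₁ + e₂ + 2)) ^ 2) := by
  have ha : a ≠ 0 := by rintro rfl; simp at hac
  have hlam : 0 < -c / a := by
    rcases lt_or_gt_of_ne ha with ha' | ha'
    · have hc : 0 < c := by nlinarith
      exact div_pos_of_neg_of_neg (by linarith) ha'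
    · have hc : c < 0 := by nlinarith
      exact div_pos (by linarith) ha'
  have hq : 0 < (-c / a) * x ^ (e₁ + e₂ + 2) := mul_pos hlam (pow_pos hx _)
  have hF : a - c * x ^ (e₁ + e₂ + 2) ≠ 0 := by
    have : a - c * x ^ (e₁ + e₂ + 2) = a * (1 + (-c / a) * x ^ (e₁ + e₂ + 2)) := by field_simp; ring
    rw [this]
    exact mul_ne_zero ha (by linarith)
  rw [knee_rowPsi1_eq e₁ e₂ a c hF]
  unfold rowU
  have h1 : (1 + (-c / a) * x ^ (e₁ + e₂ + 2)) ≠ 0 := by linarith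
  field_simp
  ring

/-- ★ **THE FAR-CLUSTER CELL: no three zeros.**  A nonempty weighted cluster `J` of TOP knees (`a_j·c_j < 0`, weights `w_j > 0`) all far
left of the window `(u,v)`, `0 < u` (`2 ≤ (−c_j/a_j)·u^q`, `q = e₁+e₂+2`), and a nonempty weighted background cloud obeying the background
law (`hrow` as in ✓ `hump_backgroundCloud_no_three_zeros`) ⇒ `Σ_j w_j ψ₁^{(j)} + cloudP1` does not vanish at three points of `(u,v)`.
[this file's theorem] -/
theorem farKneeCluster_backgroundCloud_no_three_zeros (e₁ e₂ : ℕ)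
    {κ : Type*} (J : Finset κ) (hJ : J.Nonempty) (wt aJ cJ : κ → ℝ) (hwt : ∀ j ∈ J, 0 < wt j) (hknee : ∀ j ∈ J, aJ j * cJ j < 0)
    {ι : Type*} (s : Finset ι) (hs : s.Nonempty) (m A B C : ι → ℝ) (hm : ∀ i ∈ s, 0 < m i)
    {u v : ℝ} (hu : 0 < u) (hfar : ∀ j ∈ J, 2 ≤ (-cJ j / aJ j) * u ^ (e₁ + e₂ + 2))
    (hrow : ∀ x ∈ Ioo u v, ∀ i ∈ s, A i - B i * x ^ (e₁ + 1) - C i * x ^ (e₁ + e₂ + 2) ≠ 0 ∧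
      0 < rowPsi1 e₁ e₂ (A i) (B i) (C i) x ∧ 0 ≤ (B i * x ^ (e₁ + 1)) * (C i * x ^ (e₁ + e₂ + 2)) * (A i * rowU e₁ e₂ (A i) (B i) (C i) x))
    {x₁ x₂ x₃ : ℝ} (h₁ : x₁ ∈ Ioo u v) (h₃ : x₃ ∈ Ioo u v) (h12 : x₁ < x₂) (h23 : x₂ < x₃)
    (hzero : ∀ x ∈ ({x₁, x₂, x₃} : Set ℝ), ∑ j ∈ J, wt j * rowPsi1 e₁ e₂ (aJ j) 0 (cJ j) x + cloudP1 e₁ e₂ s m A B C x = 0) : False := by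
  set n : ℕ := e₁ + e₂ + 1 with hn
  have hq : e₁ + e₂ + 2 = n + 1 := by simp [hn]
  set lam : κ → ℝ := fun j => -cJ j / aJ j with hlamdef
  have hlam : ∀ j ∈ J, 0 < lam j := by
    intro j hj
    have hac := hknee j hj
    have ha : aJ j ≠ 0 := by intro h; rw [h] at hac; simp at hac
    rcases lt_or_gt_of_ne ha with ha' | ha'
    · have hc : 0 < cJ j := by nlinarith
      exact div_pos_of_neg_of_neg (by linarith) ha'
    · have hc : cJ j < 0 := by nlinarith
      exact div_pos (by linarith) ha'
  have hxpos : ∀ x ∈ Ioo u v, 0 < x := fun x hx => hu.trans hx.1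
  -- far on the whole window
  have hfar' : ∀ x ∈ Ioo u v, ∀ j ∈ J, 2 ≤ lam j * x ^ (n + 1) := by
    intro x hx j hj
    have hux : u ^ (n + 1) ≤ x ^ (n + 1) := pow_le_pow_left₀ hu.le hx.1.le _
    have := hfar j hj
    rw [hq] at this
    calc (2 : ℝ) ≤ lam j * u ^ (n + 1) := this
      _ ≤ lam j * x ^ (n + 1) := mul_le_mul_of_nonneg_left hux (hlam j hj).le
  -- the cluster aggregate `Acl = q² Σ w_j λ_j x^q/(1+λ_j x^q)²` and its θ-tower
  set qR : ℝ := (n : ℝ) + 1 with hqR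
  set term : κ → ℝ → ℝ := fun j x => lam j * x ^ (n + 1) / (1 + lam j * x ^ (n + 1)) ^ 2 with htermdef
  set Tf : κ → ℝ → ℝ := fun j x => (lam j * x ^ (n + 1) - 1) / (lam j * x ^ (n + 1) + 1) with hTfdef
  set Acl : ℝ → ℝ := fun x => qR ^ 2 * ∑ j ∈ J, wt j * term j x with hAcldef
  set Acl₁ : ℝ → ℝ := fun x => qR ^ 2 * ∑ j ∈ J, -qR * Tf j x * (wt j * term j x) with hAcl₁def
  set Acl₂ : ℝ → ℝ := fun x => qR ^ 2 * ∑ j ∈ J, qR ^ 2 * ((3 * Tf j x ^ 2 - 1) / 2) * (wt j * term j x) with hAcl₂def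
  have hAcl : ∀ x ∈ Ioo u v, HasDerivAt Acl (Acl₁ x / x) x := by
    intro x hx
    have hx' := hxpos x hx
    have h := HasDerivAt.fun_sum (u := J) fun j hj => (hasDerivAt_kneeTerm n (hlam j hj) hx').const_mul (wt j)
    have h2 := h.const_mul (qR ^ 2)
    refine (h2.congr_of_eventuallyEq (Filter.Eventually.of_forall fun t => ?_)).congr_deriv ?_
    · simp only [hAcldef, htermdef]
    · simp only [hAcl₁def, htermdef, hTfdef, hqR, Finset.sum_div, Finset.mul_sum]
      exact Finset.sum_congr rfl fun j _ => by ring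
  have hAcl₁ : ∀ x ∈ Ioo u v, HasDerivAt Acl₁ (Acl₂ x / x) x := by
    intro x hx
    have hx' := hxpos x hx
    have h := HasDerivAt.fun_sum (u := J) fun j hj =>
      ((hasDerivAt_kneeTerm_theta n (hlam j hj) hx').const_mul (wt j)).const_mul (-qR)
    have h2 := h.const_mul (qR ^ 2)
    refine (h2.congr_of_eventuallyEq (Filter.Eventually.of_forall fun t => ?_)).congr_deriv ?_
    · simp only [hAcl₁def, htermdef, hTfdef, hqR]
      congr 1
      exact Finset.sum_congr rfl fun j _ => by ring
    · simp only [hAcl₂def, htermdef, hTfdef, hqR, Finset.sum_div, Finset.mul_sum]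
      exact Finset.sum_congr rfl fun j _ => by ring
  have hAclpos : ∀ x ∈ Ioo u v, 0 < Acl x := by
    intro x hx
    have hx' := hxpos x hx
    have hqpos : 0 < qR ^ 2 := by positivity
    refine mul_pos hqpos (Finset.sum_pos (fun j hj => mul_pos (hwt j hj) ?_) hJ)
    have hql : 0 < lam j * x ^ (n + 1) := mul_pos (hlam j hj) (pow_pos hx' _)
    exact div_pos hql (by positivity)
  have hAcl_lc : ∀ x ∈ Ioo u v, Acl x * Acl₂ x < Acl₁ x ^ 2 := by
    intro x hx
    have key := kneeAggregate_logConcave_of_far n J hJ wt lam hwt hlam (hxpos x hx) (hfar' x hx)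
    have hqpos : 0 < qR ^ 2 := by positivity
    simp only [hAcldef, hAcl₁def, hAcl₂def, htermdef, hTfdef, hqR] at key ⊢
    nlinarith [mul_lt_mul_of_pos_left key (mul_pos hqpos hqpos)]
  -- the background cloud
  have hne : ∀ x ∈ Ioo u v, ∀ i ∈ s, A i - B i * x ^ (e₁ + 1) - C i * x ^ (e₁ + e₂ + 2) ≠ 0 :=
    fun x hx i hi => (hrow x hx i hi).1
  have hG : ∀ x ∈ Ioo u v, HasDerivAt (cloudP1 e₁ e₂ s m A B C) (cloudP2 e₁ e₂ s m A B C x / x) x :=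
    fun x hx => mixedCloud_hasDerivAt1 e₁ e₂ s m A B C (hxpos x hx) (hne x hx)
  have hG₁ : ∀ x ∈ Ioo u v, HasDerivAt (cloudP2 e₁ e₂ s m A B C) (cloudP3 e₁ e₂ s m A B C x / x) x :=
    fun x hx => mixedCloud_hasDerivAt2 e₁ e₂ s m A B C (hxpos x hx) (hne x hx)
  have hGpos : ∀ x ∈ Ioo u v, 0 < cloudP1 e₁ e₂ s m A B C x :=
    fun x hx => (backgroundCloud_lcP1 e₁ e₂ hs hm (hrow x hx)).1
  have hGlx : ∀ x ∈ Ioo u v, cloudP2 e₁ e₂ s m A B C x ^ 2 ≤ cloudP1 e₁ e₂ s m A B C x * cloudP3 e₁ e₂ s m A B C x :=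
    fun x hx => (backgroundCloud_lcP1 e₁ e₂ hs hm (hrow x hx)).2
  -- the cluster sum equals `−Acl`
  have hsum : ∀ x ∈ Ioo u v, ∑ j ∈ J, wt j * rowPsi1 e₁ e₂ (aJ j) 0 (cJ j) x = -Acl x := by
    intro x hx
    have hx' := hxpos x hx
    simp only [hAcldef, htermdef, hqR, Finset.mul_sum, ← Finset.sum_neg_distrib]
    refine Finset.sum_congr rfl fun j hj => ?_
    rw [topKnee_rowPsi1_eq_aggregate e₁ e₂ (hknee j hj) hx', hq]
    simp only [hlamdef, hn]
    push_cast
    ring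
  -- zeros: `Acl = cloudP1` at the three points
  have h₂ : x₂ ∈ Ioo u v := ⟨h₁.1.trans h12, h23.trans h₃.2⟩
  have hz : ∀ x ∈ ({x₁, x₂, x₃} : Set ℝ), x ∈ Ioo u v → Acl x = cloudP1 e₁ e₂ s m A B C x := by
    intro x hx hxI
    have h := hzero x hx
    rw [hsum x hxI] at h
    linarith
  exact no_three_zeros_of_logConcave_sub_logConvex hu.le hAcl hAcl₁ hG hG₁ hAclpos hGpos hAcl_lc hGlx h₁ h₃ h12 h23
    (hz _ (by simp) h₁) (hz _ (by simp) h₂) (hz _ (by simp) h₃)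

/-- ★ **THE FAR-CLUSTER CELL, mirror: all knees far RIGHT of the window** (`(−c_j/a_j)·v^q ≤ 1/2`, i.e. centres at distance `≥ ln 2/q` to the
right of `log v`); otherwise as `farKneeCluster_backgroundCloud_no_three_zeros`. [this file's theorem] -/
theorem farKneeCluster_backgroundCloud_no_three_zeros_right (e₁ e₂ : ℕ)
    {κ : Type*} (J : Finset κ) (hJ : J.Nonempty) (wt aJ cJ : κ → ℝ) (hwt : ∀ j ∈ J, 0 < wt j) (hknee : ∀ j ∈ J, aJ j * cJ j < 0)
    {ι : Type*} (s : Finset ι) (hs : s.Nonempty) (m A B C : ι → ℝ) (hm : ∀ i ∈ s, 0 < m i)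
    {u v : ℝ} (hu : 0 < u) (hnear : ∀ j ∈ J, (-cJ j / aJ j) * v ^ (e₁ + e₂ + 2) ≤ 1 / 2)
    (hrow : ∀ x ∈ Ioo u v, ∀ i ∈ s, A i - B i * x ^ (e₁ + 1) - C i * x ^ (e₁ + e₂ + 2) ≠ 0 ∧
      0 < rowPsi1 e₁ e₂ (A i) (B i) (C i) x ∧ 0 ≤ (B i * x ^ (e₁ + 1)) * (C i * x ^ (e₁ + e₂ + 2)) * (A i * rowU e₁ e₂ (A i) (B i) (C i) x))
    {x₁ x₂ x₃ : ℝ} (h₁ : x₁ ∈ Ioo u v) (h₃ : x₃ ∈ Ioo u v) (h12 : x₁ < x₂) (h23 : x₂ < x₃)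
    (hzero : ∀ x ∈ ({x₁, x₂, x₃} : Set ℝ), ∑ j ∈ J, wt j * rowPsi1 e₁ e₂ (aJ j) 0 (cJ j) x + cloudP1 e₁ e₂ s m A B C x = 0) : False := by
  set n : ℕ := e₁ + e₂ + 1 with hn
  have hq : e₁ + e₂ + 2 = n + 1 := by simp [hn]
  set lam : κ → ℝ := fun j => -cJ j / aJ j with hlamdef
  have hlam : ∀ j ∈ J, 0 < lam j := by
    intro j hj
    have hac := hknee j hj
    have ha : aJ j ≠ 0 := by intro h; rw [h] at hac; simp at hac
    rcases lt_or_gt_of_ne ha with ha' | ha'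
    · have hc : 0 < cJ j := by nlinarith
      exact div_pos_of_neg_of_neg (by linarith) ha'
    · have hc : cJ j < 0 := by nlinarith
      exact div_pos (by linarith) ha'
  have hxpos : ∀ x ∈ Ioo u v, 0 < x := fun x hx => hu.trans hx.1
  -- near (≤ 1/2) on the whole window
  have hnear' : ∀ x ∈ Ioo u v, ∀ j ∈ J, lam j * x ^ (n + 1) ≤ 1 / 2 := by
    intro x hx j hj
    have hxv : x ^ (n + 1) ≤ v ^ (n + 1) := pow_le_pow_left₀ (hxpos x hx).le hx.2.le _
    have := hnear j hj
    rw [hq] at this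
    calc lam j * x ^ (n + 1) ≤ lam j * v ^ (n + 1) := mul_le_mul_of_nonneg_left hxv (hlam j hj).le
      _ ≤ 1 / 2 := this
  -- the cluster aggregate `Acl = q² Σ w_j λ_j x^q/(1+λ_j x^q)²` and its θ-tower
  set qR : ℝ := (n : ℝ) + 1 with hqR
  set term : κ → ℝ → ℝ := fun j x => lam j * x ^ (n + 1) / (1 + lam j * x ^ (n + 1)) ^ 2 with htermdef
  set Tf : κ → ℝ → ℝ := fun j x => (lam j * x ^ (n + 1) - 1) / (lam j * x ^ (n + 1) + 1) with hTfdef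
  set Acl : ℝ → ℝ := fun x => qR ^ 2 * ∑ j ∈ J, wt j * term j x with hAcldef
  set Acl₁ : ℝ → ℝ := fun x => qR ^ 2 * ∑ j ∈ J, -qR * Tf j x * (wt j * term j x) with hAcl₁def
  set Acl₂ : ℝ → ℝ := fun x => qR ^ 2 * ∑ j ∈ J, qR ^ 2 * ((3 * Tf j x ^ 2 - 1) / 2) * (wt j * term j x) with hAcl₂def
  have hAcl : ∀ x ∈ Ioo u v, HasDerivAt Acl (Acl₁ x / x) x := by
    intro x hx
    have hx' := hxpos x hx
    have h := HasDerivAt.fun_sum (u := J) fun j hj => (hasDerivAt_kneeTerm n (hlam j hj) hx').const_mul (wt j)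
    have h2 := h.const_mul (qR ^ 2)
    refine (h2.congr_of_eventuallyEq (Filter.Eventually.of_forall fun t => ?_)).congr_deriv ?_
    · simp only [hAcldef, htermdef]
    · simp only [hAcl₁def, htermdef, hTfdef, hqR, Finset.sum_div, Finset.mul_sum]
      exact Finset.sum_congr rfl fun j _ => by ring
  have hAcl₁ : ∀ x ∈ Ioo u v, HasDerivAt Acl₁ (Acl₂ x / x) x := by
    intro x hx
    have hx' := hxpos x hx
    have h := HasDerivAt.fun_sum (u := J) fun j hj =>
      ((hasDerivAt_kneeTerm_theta n (hlam j hj) hx').const_mul (wt j)).const_mul (-qR)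
    have h2 := h.const_mul (qR ^ 2)
    refine (h2.congr_of_eventuallyEq (Filter.Eventually.of_forall fun t => ?_)).congr_deriv ?_
    · simp only [hAcl₁def, htermdef, hTfdef, hqR]
      congr 1
      exact Finset.sum_congr rfl fun j _ => by ring
    · simp only [hAcl₂def, htermdef, hTfdef, hqR, Finset.sum_div, Finset.mul_sum]
      exact Finset.sum_congr rfl fun j _ => by ring
  have hAclpos : ∀ x ∈ Ioo u v, 0 < Acl x := by
    intro x hx
    have hx' := hxpos x hx
    have hqpos : 0 < qR ^ 2 := by positivity
    refine mul_pos hqpos (Finset.sum_pos (fun j hj => mul_pos (hwt j hj) ?_) hJ)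
    have hql : 0 < lam j * x ^ (n + 1) := mul_pos (hlam j hj) (pow_pos hx' _)
    exact div_pos hql (by positivity)
  have hAcl_lc : ∀ x ∈ Ioo u v, Acl x * Acl₂ x < Acl₁ x ^ 2 := by
    intro x hx
    have key := kneeAggregate_logConcave_of_near n J hJ wt lam hwt hlam (hxpos x hx) (hnear' x hx)
    have hqpos : 0 < qR ^ 2 := by positivity
    simp only [hAcldef, hAcl₁def, hAcl₂def, htermdef, hTfdef, hqR] at key ⊢
    nlinarith [mul_lt_mul_of_pos_left key (mul_pos hqpos hqpos)]
  -- the background cloud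
  have hne : ∀ x ∈ Ioo u v, ∀ i ∈ s, A i - B i * x ^ (e₁ + 1) - C i * x ^ (e₁ + e₂ + 2) ≠ 0 :=
    fun x hx i hi => (hrow x hx i hi).1
  have hG : ∀ x ∈ Ioo u v, HasDerivAt (cloudP1 e₁ e₂ s m A B C) (cloudP2 e₁ e₂ s m A B C x / x) x :=
    fun x hx => mixedCloud_hasDerivAt1 e₁ e₂ s m A B C (hxpos x hx) (hne x hx)
  have hG₁ : ∀ x ∈ Ioo u v, HasDerivAt (cloudP2 e₁ e₂ s m A B C) (cloudP3 e₁ e₂ s m A B C x / x) x :=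
    fun x hx => mixedCloud_hasDerivAt2 e₁ e₂ s m A B C (hxpos x hx) (hne x hx)
  have hGpos : ∀ x ∈ Ioo u v, 0 < cloudP1 e₁ e₂ s m A B C x :=
    fun x hx => (backgroundCloud_lcP1 e₁ e₂ hs hm (hrow x hx)).1
  have hGlx : ∀ x ∈ Ioo u v, cloudP2 e₁ e₂ s m A B C x ^ 2 ≤ cloudP1 e₁ e₂ s m A B C x * cloudP3 e₁ e₂ s m A B C x :=
    fun x hx => (backgroundCloud_lcP1 e₁ e₂ hs hm (hrow x hx)).2
  -- the cluster sum equals `−Acl`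
  have hsum : ∀ x ∈ Ioo u v, ∑ j ∈ J, wt j * rowPsi1 e₁ e₂ (aJ j) 0 (cJ j) x = -Acl x := by
    intro x hx
    have hx' := hxpos x hx
    simp only [hAcldef, htermdef, hqR, Finset.mul_sum, ← Finset.sum_neg_distrib]
    refine Finset.sum_congr rfl fun j hj => ?_
    rw [topKnee_rowPsi1_eq_aggregate e₁ e₂ (hknee j hj) hx', hq]
    simp only [hlamdef, hn]
    push_cast
    ring
  -- zeros: `Acl = cloudP1` at the three points
  have h₂ : x₂ ∈ Ioo u v := ⟨h₁.1.trans h12, h23.trans h₃.2⟩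
  have hz : ∀ x ∈ ({x₁, x₂, x₃} : Set ℝ), x ∈ Ioo u v → Acl x = cloudP1 e₁ e₂ s m A B C x := by
    intro x hx hxI
    have h := hzero x hx
    rw [hsum x hxI] at h
    linarith
  exact no_three_zeros_of_logConcave_sub_logConvex hu.le hAcl hAcl₁ hG hG₁ hAclpos hGpos hAcl_lc hGlx h₁ h₃ h12 h23
    (hz _ (by simp) h₁) (hz _ (by simp) h₂) (hz _ (by simp) h₃)

end ProductPlusOne

end Summit.ValiantsHypothesis.ValiantsHypothesis.Theorems.LacunarySymmetroidMatrixDescartes
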